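import Literature.MathematicalPhysics.QuantumFieldTheory.Balaban1983to89.B15SU2ChartHolomorphic

/-!
# `Balaban1983to89.B15AveragingAnalytic` — [Balaban1987RG1] = «[I]», (0.4) p. 253 («we assume that it is an analytic function»), (0.21) p. 256; [Balaban1985Averaging] (21) p. 21
# («analytic functions of complex matrices»); [Balaban1985Variational] = «[15]», p. 307, Sect. G p. 305, Prop. 9 (190) p. 309:
# THE HOLOMORPHIC AVERAGING AND THE LOGARITHMIC COORDINATES ARE ℂ-ANALYTIC (every class `C^n`, `n ≤ ω`) — the regularity the complex implicit-function theorem asks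

Honest framing: statement-level skeleton of published theorems with citation tags; proofs where landed; nothing here is a claim about the
Yang–Mills mass gap.  Cell `pub-ymgap`, HUMAN RULING D-0149 (width seats), seat `pub-ymgap-dag-n12-w1` (g2; N12 = [B15]; U1a⁺ of the w1 lineage, U1A-CENSUS §4 item 1 (δ′));
count-neutral; N12 NOT discharged; finite 𝕋⁴ at fixed ε; nothing continuum ∕ OS ∕ mass-gap ∕ Clay.

WHY.  The complex implicit-function route to (J0′) (`B15Prop1CriticalChartFromIFT.exists_localChart_of_criticalFamily`, via `ConstrainedCriticalFamily`) asks the action and the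
constraint IN COORDINATES to be of class `C^{m+1}`, `m ≥ 1` — at least `C²`, in practice `C^ω`.  This seat's g0 kit (`B15AveragingHolomorphic`, `B15SU2ChartHolomorphic`) recorded
ℂ-DIFFERENTIABILITY of the holomorphic averaging `avgMh`∕`iterMh` and of the logarithmic coordinates `logCoordC`; in several complex variables Mathlib has no «holomorphic ⇒
analytic» (Hartogs∕Osgood), so the class must be read off the CONSTRUCTION: walk products and adjugates are polynomial, the `exp[mean log]` of (0.4) is the tree's ANALYTIC `eml`
(`ExpMeanLog.analyticAt_eml`), the logarithm (21) is the analytic series `MatrixLog.analyticAt_mlog`.  THIS MODULE replays the g0 differentiability chain at the level `AnalyticAt ℂ`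
(hence `ContDiffAt ℂ n` for every `n`).

CONTENTS (theorems only; no `def`, no `instance`, no `sorry`).  §0 `analyticAt_entry`, `analyticAt_det` (Leibniz), `analyticAt_of_entries` (a matrix-valued map is analytic when its
entries are — through the linear identification `Matrix.ofLinearEquiv` of the L2-operator-normed matrices with the product space), `analyticAt_adjugate`.  §1 `analyticAt_stepMh`,
`analyticAt_holMh`.  §2 ★ `analyticAt_avgMh` (at every field whose (0.4) loop matrices lie in the polydisc `‖W − 1‖ < 1`).  §3 ★★ `analyticAt_iterMh_of_polydisc`, `contDiffAt_iterMh_of_polydisc`,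
`analyticAt_iterMh_coeField` (at a guarded `SU(N)` field).  §4 ★ `analyticAt_logCoordC` (`‖A − 1‖ < 1`), `contDiffAt_logCoordC`, `analyticAt_expPointC`-free (see `B15Prop1StateChartSU2`).
-/

noncomputable section

namespace Literature.MathematicalPhysics.QuantumFieldTheory.Balaban1983to89.B15AveragingAnalytic

open scoped Topology ContDiff
open Literature.MathematicalPhysics.QuantumFieldTheory.Balaban1983to89.Node00 (SU coeField coeField_apply SmallBelow)
open B15AveragingHolomorphic (stepMh holMh holMh_nil holMh_cons loopMh axialMh corrMh avgMh iterMh iterMh_zero iterMh_succ loopMh_coeField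
  coeField_iter_eq_iterMh)
open B15SU2ChartHolomorphic (genE logCoordC logCoordC_apply)
open ExpMeanLog (eml analyticAt_eml expMeanLogSU)
open MatrixLog (mlog analyticAt_mlog)
open BlockAveraging (Small Idx blockAvg)
open T4Continuum
open scoped Matrix.Norms.L2Operator

/-! ## §0  Entries, determinant, adjugate -/

section Entries

variable {N : ℕ} {X : Type*} [NormedAddCommGroup X] [NormedSpace ℂ X]

/-- An entry `A ↦ A i j` is analytic (a continuous linear functional). [cite: Balaban1985Averaging, (21) p.21 (bookkeeping)] -/
theorem analyticAt_entry (i j : Fin N) (A : Matrix (Fin N) (Fin N) ℂ) : AnalyticAt ℂ (fun M : Matrix (Fin N) (Fin N) ℂ => M i j) A :=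
  (LinearMap.toContinuousLinearMap (Matrix.entryLinearMap ℂ ℂ i j)).analyticAt A

set_option backward.isDefEq.respectTransparency false in
/-- **THE DETERMINANT IS ENTIRE** (Leibniz expansion: a finite sum of finite products of entries; cf. the tree's `B13HaarSigma.analyticAt_det` in the `l∞`-operator scope).
[cite: Balaban1985Averaging, (21) p.21 (bookkeeping)] -/
theorem analyticAt_det (A : Matrix (Fin N) (Fin N) ℂ) : AnalyticAt ℂ (fun M : Matrix (Fin N) (Fin N) ℂ => M.det) A := by
  have hfun : (fun M : Matrix (Fin N) (Fin N) ℂ => M.det) =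
      fun M => ∑ σ : Equiv.Perm (Fin N), ((Equiv.Perm.sign σ : ℤ) : ℂ) * ∏ i, M (σ i) i := by
    funext M; rw [Matrix.det_apply']
  rw [hfun]
  refine Finset.analyticAt_fun_sum _ fun σ _ => ?_
  refine analyticAt_const.mul (Finset.analyticAt_fun_prod _ fun i _ => ?_)
  exact analyticAt_entry (σ i) i A

/-- **A MATRIX-VALUED MAP IS ANALYTIC WHEN ITS ENTRIES ARE** (the L2-operator-normed `M_N(ℂ)` is the image of the product space `Fin N → Fin N → ℂ` under the continuous linear
identification `Matrix.ofLinearEquiv`; analyticity of a product-valued map is coordinatewise). [cite: Balaban1985Averaging, (21) p.21 (bookkeeping)] -/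
theorem analyticAt_of_entries {f : X → Matrix (Fin N) (Fin N) ℂ} {x : X} (hf : ∀ i j, AnalyticAt ℂ (fun y => f y i j) x) : AnalyticAt ℂ f x := by
  let e : (Fin N → Fin N → ℂ) ≃L[ℂ] Matrix (Fin N) (Fin N) ℂ := (Matrix.ofLinearEquiv ℂ).toContinuousLinearEquiv
  have hg : AnalyticAt ℂ (fun y => fun i j => f y i j) x :=
    analyticAt_pi_iff.2 fun i => analyticAt_pi_iff.2 fun j => hf i j
  have h := (e : (Fin N → Fin N → ℂ) →L[ℂ] Matrix (Fin N) (Fin N) ℂ).analyticAt (fun i j => f x i j)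
  have hcomp := h.comp hg
  exact hcomp

/-- **THE ADJUGATE IS ENTIRE** (each entry is a determinant of an affine function of the matrix). [cite: Balaban1985Variational, p.307 («valid for Gᶜ-valued fields»; bookkeeping)] -/
theorem analyticAt_adjugate (A : Matrix (Fin N) (Fin N) ℂ) : AnalyticAt ℂ (fun M : Matrix (Fin N) (Fin N) ℂ => M.adjugate) A := by
  refine analyticAt_of_entries fun i j => ?_
  have hfun : (fun M : Matrix (Fin N) (Fin N) ℂ => M.adjugate i j) = fun M => (M.updateRow j (Pi.single i 1)).det := by
    funext M; rw [Matrix.adjugate_apply]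
  rw [hfun]
  have hupd : AnalyticAt ℂ (fun M : Matrix (Fin N) (Fin N) ℂ => M.updateRow j (Pi.single i 1)) A := by
    refine analyticAt_of_entries fun a c => ?_
    by_cases ha : a = j
    · subst ha
      have h : (fun M : Matrix (Fin N) (Fin N) ℂ => M.updateRow a (Pi.single i (1 : ℂ)) a c) = fun _ => (Pi.single i (1 : ℂ) : Fin N → ℂ) c := by
        funext M; rw [Matrix.updateRow_self]
      rw [h]; exact analyticAt_const
    · have h : (fun M : Matrix (Fin N) (Fin N) ℂ => M.updateRow j (Pi.single i (1 : ℂ)) a c) = fun M => M a c := by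
        funext M; rw [Matrix.updateRow_ne ha]
      rw [h]; exact analyticAt_entry a c A
  exact (analyticAt_det _).comp hupd

end Entries

/-! ## §1  Holomorphic walk products are analytic -/

section Walks

variable {P : Params} {j N : ℕ}

/-- A holomorphic step matrix is an analytic function of the field (evaluation, possibly followed by the adjugate). [cite: Balaban1985Variational, p.307 (bookkeeping)] -/
theorem analyticAt_stepMh (s : LStep P j) (V : PBond P j → Matrix (Fin N) (Fin N) ℂ) :
    AnalyticAt ℂ (fun V : PBond P j → Matrix (Fin N) (Fin N) ℂ => stepMh V s) V := by
  have hev : AnalyticAt ℂ (fun V : PBond P j → Matrix (Fin N) (Fin N) ℂ => V s.bond) V :=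
    (ContinuousLinearMap.proj (R := ℂ) (φ := fun _ : PBond P j => Matrix (Fin N) (Fin N) ℂ) s.bond).analyticAt V
  unfold stepMh
  by_cases h : s.fwd
  · simp only [h, if_true]
    exact hev
  · simp only [h]
    exact (analyticAt_adjugate _).comp hev

/-- ★ **HOLOMORPHIC WALK PRODUCTS ARE ANALYTIC** (finite products in the normed algebra `M_N(ℂ)`). [cite: Balaban1985Variational, p.307; Balaban1987RG1, (0.4) p.253 («analytic function»)] -/
theorem analyticAt_holMh (V : PBond P j → Matrix (Fin N) (Fin N) ℂ) :
    ∀ γ : List (LStep P j), AnalyticAt ℂ (fun V : PBond P j → Matrix (Fin N) (Fin N) ℂ => holMh V γ) V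
  | [] => by
    simp only [holMh_nil]
    exact analyticAt_const
  | s :: γ => by
    simp only [holMh_cons]
    exact (analyticAt_stepMh s V).mul (analyticAt_holMh V γ)

end Walks

/-! ## §2  The one-step holomorphic averaging (0.4) is analytic on the polydisc -/

section OneStep

variable {P : Params} {j N : ℕ}

/-- ★ **THE HOLOMORPHIC AVERAGING (0.4) IS ANALYTIC** at every field whose loop matrices lie in the polydisc `‖W − 1‖ < 1` (analytic loop ∕ segment products, the analytic
`exp[mean log]` `ExpMeanLog.analyticAt_eml`, products in `M_N(ℂ)`). [cite: Balaban1987RG1, (0.4) p.253 («we assume that it is an analytic function»); Balaban1985Variational, Prop. 9 p.309] -/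
theorem analyticAt_avgMh {V₀ : PBond P j → Matrix (Fin N) (Fin N) ℂ} (h : ∀ (c : PBond P (j + 1)) (i : Idx P), ‖loopMh V₀ c i - 1‖ < 1) :
    AnalyticAt ℂ (avgMh : (PBond P j → Matrix (Fin N) (Fin N) ℂ) → PBond P (j + 1) → Matrix (Fin N) (Fin N) ℂ) V₀ := by
  refine analyticAt_pi_iff.2 fun c => ?_
  have hin : AnalyticAt ℂ (fun V : PBond P j → Matrix (Fin N) (Fin N) ℂ => fun i : Idx P => loopMh V c i) V₀ :=
    analyticAt_pi_iff.2 fun i => analyticAt_holMh V₀ _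
  have heml : AnalyticAt ℂ (eml : (Idx P → Matrix (Fin N) (Fin N) ℂ) → Matrix (Fin N) (Fin N) ℂ) (fun i => loopMh V₀ c i) :=
    analyticAt_eml (𝔸 := Matrix (Fin N) (Fin N) ℂ) (h c)
  have hcorr : AnalyticAt ℂ (fun V : PBond P j → Matrix (Fin N) (Fin N) ℂ => corrMh V c) V₀ := heml.comp hin
  exact hcorr.mul (analyticAt_holMh V₀ _)

end OneStep

/-! ## §3  The iterated holomorphic averaging is analytic on the iterated polydisc -/

section Iterate

variable {P : Params} {N : ℕ}

/-- ★★ **THE `k`-FOLD HOLOMORPHIC AVERAGING IS ANALYTIC** at every field whose iterates `iterMh j V`, `j < k`, have their (0.4) loop matrices in the polydisc (the general-point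
analytic edition of `B15ComplexifiedDatumFamily.differentiableAt_iterMh_of_polydisc`). [cite: Balaban1987RG1, (0.4) p.253, (0.21) p.256; Balaban1985Variational, Prop. 9 p.309] -/
theorem analyticAt_iterMh_of_polydisc {V : PBond P 0 → Matrix (Fin N) (Fin N) ℂ} :
    ∀ k, (∀ j, j < k → ∀ (c : PBond P (j + 1)) (i : Idx P), ‖loopMh (iterMh j V) c i - 1‖ < 1) →
      AnalyticAt ℂ (iterMh k : (PBond P 0 → Matrix (Fin N) (Fin N) ℂ) → PBond P k → Matrix (Fin N) (Fin N) ℂ) V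
  | 0, _ => by
    have h : (iterMh 0 : (PBond P 0 → Matrix (Fin N) (Fin N) ℂ) → PBond P 0 → Matrix (Fin N) (Fin N) ℂ) = id := funext fun W => iterMh_zero W
    rw [h]; exact analyticAt_id
  | k + 1, h => by
    have ih := analyticAt_iterMh_of_polydisc k fun j hj => h j (Nat.lt_succ_of_lt hj)
    have hk : AnalyticAt ℂ (avgMh : (PBond P k → Matrix (Fin N) (Fin N) ℂ) → PBond P (k + 1) → Matrix (Fin N) (Fin N) ℂ) (iterMh k V) :=
      analyticAt_avgMh (h k (Nat.lt_succ_self k))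
    have hfun : (iterMh (k + 1) : (PBond P 0 → Matrix (Fin N) (Fin N) ℂ) → PBond P (k + 1) → Matrix (Fin N) (Fin N) ℂ) = avgMh ∘ iterMh k :=
      funext fun W => iterMh_succ k W
    rw [hfun]
    exact hk.comp ih

/-- The class `C^n`, every `n ≤ ω`, of the iterated holomorphic averaging on the iterated polydisc. [cite: Balaban1987RG1, (0.4) p.253; Balaban1985Variational, Prop. 9 p.309] -/
theorem contDiffAt_iterMh_of_polydisc {V : PBond P 0 → Matrix (Fin N) (Fin N) ℂ} (k : ℕ)
    (h : ∀ j, j < k → ∀ (c : PBond P (j + 1)) (i : Idx P), ‖loopMh (iterMh j V) c i - 1‖ < 1) {n : WithTop ℕ∞} :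
    ContDiffAt ℂ n (iterMh k : (PBond P 0 → Matrix (Fin N) (Fin N) ℂ) → PBond P k → Matrix (Fin N) (Fin N) ℂ) V :=
  (analyticAt_iterMh_of_polydisc k h).contDiffAt

variable [NeZero N] in
/-- **AT A GUARDED `SU(N)` FIELD** (every iterate `< k` small in the sense of (0.4)'s guard) the iterated holomorphic averaging is analytic — the polydisc hypothesis from n07-e's
`norm_loopM_coeField_sub_one_lt_one`, through g0's `iterMh_coeField_eq_iterM`. [cite: Balaban1987RG1, (0.4) p.253, (0.21) p.256; Balaban1985Variational, Prop. 9 p.309] -/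
theorem analyticAt_iterMh_coeField {U : GaugeField P 0 (SU N)} {k : ℕ} (h : SmallBelow (fun j => blockAvg (P := P) (j := j) expMeanLogSU) k U) :
    AnalyticAt ℂ (iterMh k : (PBond P 0 → Matrix (Fin N) (Fin N) ℂ) → PBond P k → Matrix (Fin N) (Fin N) ℂ) (coeField U) := by
  refine analyticAt_iterMh_of_polydisc k fun j hj c i => ?_
  have hsb : SmallBelow (fun j => blockAvg (P := P) (j := j) expMeanLogSU) j U := fun j' hj' c' => h j' (lt_trans hj' hj) c'
  rw [← coeField_iter_eq_iterMh j hsb, loopMh_coeField]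
  exact Node00.norm_loopM_coeField_sub_one_lt_one _ c (h j hj c) i

end Iterate

/-! ## §4  The logarithmic coordinates are analytic near `1` -/

section Log

/-- ★ **THE LOGARITHMIC COORDINATES ARE ANALYTIC** at every `A` with `‖A − 1‖ < 1` (the series logarithm `MatrixLog.analyticAt_mlog`; traces of products with fixed matrices are
linear). [cite: Balaban1985Averaging, (21) p.21 («analytic functions of complex matrices»); Balaban1989LargeFieldII, (1.19) p.360] -/
theorem analyticAt_logCoordC {A : Matrix (Fin 2) (Fin 2) ℂ} (hA : ‖A - 1‖ < 1) : AnalyticAt ℂ logCoordC A := by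
  let e : EuclideanSpace ℂ (Fin 3) ≃L[ℂ] (Fin 3 → ℂ) := PiLp.continuousLinearEquiv 2 ℂ (fun _ : Fin 3 => ℂ)
  have hg : AnalyticAt ℂ (fun B : Matrix (Fin 2) (Fin 2) ℂ => fun a : Fin 3 => -(1 / 2 : ℂ) * (genE a * mlog B).trace) A := by
    refine analyticAt_pi_iff.2 fun a => ?_
    have htr : AnalyticAt ℂ (fun M : Matrix (Fin 2) (Fin 2) ℂ => (genE a * M).trace) (mlog A) :=
      (LinearMap.toContinuousLinearMap ((Matrix.traceLinearMap (Fin 2) ℂ ℂ).comp (LinearMap.mulLeft ℂ (genE a)))).analyticAt (mlog A)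
    exact analyticAt_const.mul (htr.comp (analyticAt_mlog hA))
  have hfun : logCoordC = (e.symm : (Fin 3 → ℂ) → EuclideanSpace ℂ (Fin 3)) ∘
      fun B : Matrix (Fin 2) (Fin 2) ℂ => fun a : Fin 3 => -(1 / 2 : ℂ) * (genE a * mlog B).trace := by
    funext B; rfl
  rw [hfun]
  exact ((e.symm : (Fin 3 → ℂ) →L[ℂ] EuclideanSpace ℂ (Fin 3)).analyticAt _).comp hg

/-- The class `C^n`, every `n ≤ ω`, of the logarithmic coordinates near `1`. [cite: Balaban1985Averaging, (21) p.21 (bookkeeping)] -/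
theorem contDiffAt_logCoordC {A : Matrix (Fin 2) (Fin 2) ℂ} (hA : ‖A - 1‖ < 1) {n : WithTop ℕ∞} : ContDiffAt ℂ n logCoordC A :=
  (analyticAt_logCoordC hA).contDiffAt

end Log

end Literature.MathematicalPhysics.QuantumFieldTheory.Balaban1983to89.B15AveragingAnalytic

end
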